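import Summits.CriticalPhenomena.PercolationContinuityZ3.Theorems.PercNearOneGluingNoHeavyLowerTailSahiCombTriWTranslate

/-!
# CERT-GEN(q): the one-parameter q-zeta rank certificate for the two-block translate inequality — kernel statement (typed) and its
# Hall consequence (proved)

Support file of the one-cut programme (crux `NoHeavyLowerTail`, stmt-CriticalPhenomena-4575; cell `prim-masterthm`, seat P5 gen 18;
memo `FROM-prim-masterthm-p5-g18-SYMMETRIC-MASTER-FORM.md` §4, §9).

For up-sets `X, Y` of the cube `Finset α` and a translate `t`, put `W = X ∩ Y`, `E = refl X ∩ transl t Y` (`= σX ∩ (Y+t)`), and consider the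
DEMAND families `D₁ = refl X ∩ Y`, `D₂ = X ∩ refl Y`, `D₃ = refl (X ∩ Y)` and the SUPPLY families `W` (twice) and `E`.  The memo's census says
that the matrix
        `D₁ : [ ζ | ζ_q | 0 ]`,   `D₂ : [ 0 | ζ | 0 ]`,   `D₃ : [ ζ_q | 0 | ζ ]`      (`ζ(d,u) = [d ⊆ u]`, `ζ_q(d,u) = [d ⊆ u]·q^{#(u \ d)}`)
(rows = demand points, column blocks = `W`, `W`, `E`) has FULL ROW RANK for generic `q` on every configuration of `Z₂^m`, `m ≤ 4` (exhaustive,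
446,224 configurations at `m = 4`) and on 1.8·10⁶ sampled configurations at `m = 5, 6`; `q = 1` (plain zeta) and `q = −1` (Möbius) fail.
Because every entry `[d ⊆ u]…` vanishes unless `u ⊇ d`, full row rank gives, for EVERY up-set `h`, the counting inequality
`#(h∩D₁) + #(h∩D₂) + #(h∩D₃) ≤ 2#(h∩W) + #(h∩E)` — which is the two-block ("(GEN)") case of the symmetric translate conjecture (SYM)
(`FiveUpSet.TranslateIneq`) in single-cube form, the case that contains the crux target `TriWIneq`.

* `FiveUpSet.qzeta q d u = [d ⊆ u]·q^{#(u \ d)}`;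
* `FiveUpSet.CertGenKernelAt X Y t q` — the kernel statement at one configuration and one `q` (function language, as `rankZ_kernel_eq_zero`);
* **`FiveUpSet.CertGenKernel`** (`@[conjecture]`, an obligation of our theory, never a fact) — for all up-sets `X, Y` and all `t` SOME rational `q` has
  trivial kernel (equivalent to generic full rank);
* **`FiveUpSet.dipoleIneq_of_certGenKernel`** (proved) — `CertGenKernel →` for all up-sets `X, Y, h` and all `t`:
  `#(refl X ∩ Y ∩ h) + #(X ∩ refl Y ∩ h) + #(refl (X ∩ Y) ∩ h) ≤ 2·#(X ∩ Y ∩ h) + #(refl X ∩ transl t Y ∩ h)`.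
What is NOT here: the identification of this single-cube inequality (over the cube `Finset (β ⊕ γ)`) with `TriWGenIneq` for families
`Finset β → Finset (Finset γ)` (memo §3: it is (SYM) at the 2-block configurations) — routine product-cube plumbing left to the next seat —
and, of course, a proof of `CertGenKernel`.
HONEST LABEL: one definition, one typed conjecture (census-clean, OPEN) and one proved reduction (linear independence ⇒ counting). [this work]
-/

namespace Summit.CriticalPhenomena.PercolationContinuityZ3.Theorems

namespace FiveUpSet

open Finset

variable {α : Type} [DecidableEq α] [Fintype α]

/-- The `q`-deformed zeta function of the cube: `qzeta q d u = q^{#(u \ d)}` if `d ⊆ u`, else `0` (`q = 1`: zeta; `q = 0`: identity;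
`q = −1`: signed Möbius). [this work] -/
def qzeta (q : ℚ) (d u : Finset α) : ℚ := if d ⊆ u then q ^ (u \ d).card else 0

omit [Fintype α] in
/-- `qzeta` vanishes off `d ⊆ u`. [this work] -/
theorem qzeta_eq_zero_of_not_subset {q : ℚ} {d u : Finset α} (h : ¬ d ⊆ u) : qzeta q d u = 0 := by
  unfold qzeta; rw [if_neg h]

/-- **CERT-GEN(q) at one configuration** (kernel form, function language).  For up-sets `X, Y`, a translate `t` and `q : ℚ`:
every triple of coefficient vectors `a` (supported on `refl X ∩ Y`), `b` (on `X ∩ refl Y`), `c` (on `refl (X ∩ Y)`) with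
`Σ_d a_d [d ⊆ u] + Σ_d c_d ζ_q(d,u) = 0` and `Σ_d a_d ζ_q(d,u) + Σ_d b_d [d ⊆ u] = 0` for all `u ∈ X ∩ Y`, and `Σ_d c_d [d ⊆ u] = 0` for all
`u ∈ refl X ∩ transl t Y`, vanishes identically. [this work] -/
def CertGenKernelAt (X Y : Finset (Finset α)) (t : Finset α) (q : ℚ) : Prop :=
  ∀ a b c : Finset α → ℚ,
    (∀ d, a d ≠ 0 → d ∈ refl X ∩ Y) → (∀ d, b d ≠ 0 → d ∈ X ∩ refl Y) → (∀ d, c d ≠ 0 → d ∈ refl (X ∩ Y)) →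
    (∀ u, u ∈ X ∩ Y → ∑ d, a d * (if d ⊆ u then (1 : ℚ) else 0) + ∑ d, c d * qzeta q d u = 0) →
    (∀ u, u ∈ X ∩ Y → ∑ d, a d * qzeta q d u + ∑ d, b d * (if d ⊆ u then (1 : ℚ) else 0) = 0) →
    (∀ u, u ∈ refl X ∩ transl t Y → ∑ d, c d * (if d ⊆ u then (1 : ℚ) else 0) = 0) →
    (∀ d, a d = 0) ∧ (∀ d, b d = 0) ∧ (∀ d, c d = 0)

/-- **CERT-GEN** (CONJECTURE — an obligation of our theory, never a fact; memo §9): for all up-sets `X, Y` of a finite cube and every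
translate `t`, SOME rational `q` makes the kernel of the certificate trivial (equivalently: the certificate has full row rank for generic `q`).
Census: exhaustive on `Z₂^m`, `m ≤ 4`; 1.8·10⁶ sampled configurations at `m = 5, 6`; `q ∈ {0, 1, −1, 2}` do NOT always work. OPEN. [this work] -/
@[conjecture] def CertGenKernel : Prop :=
  ∀ (α : Type) [DecidableEq α] [Fintype α] (X Y : Finset (Finset α)) (t : Finset α),
    IsUpperSet (X : Set (Finset α)) → IsUpperSet (Y : Set (Finset α)) → ∃ q : ℚ, CertGenKernelAt X Y t q

/-! ### Restriction to an up-set is free -/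

omit [DecidableEq α] in
/-- A zeta-type sum supported inside an up-set `h` vanishes at every `u ∉ h`. [this work] -/
theorem sum_supported_eq_zero_of_not_mem {h : Finset (Finset α)} (hh : IsUpperSet (h : Set (Finset α)))
    (x : Finset α → ℚ) (φ : Finset α → Finset α → ℚ) (hφ : ∀ d u, ¬ d ⊆ u → φ d u = 0)
    (hx : ∀ d, x d ≠ 0 → d ∈ h) (u : Finset α) (hu : u ∉ h) :
    ∑ d, x d * φ d u = 0 := by
  refine Finset.sum_eq_zero fun d _ => ?_
  by_cases hd : x d = 0
  · rw [hd, zero_mul]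
  · have hdu : ¬ d ⊆ u := fun hsub => hu (hh hsub (hx d hd))
    rw [hφ d u hdu, mul_zero]

/-! ### The Hall consequence -/

/-- **CERT-GEN ⟹ the two-block translate inequality (single-cube dipole form).**  For up-sets `X, Y, h` and any translate `t`:
`#(refl X ∩ Y ∩ h) + #(X ∩ refl Y ∩ h) + #(refl (X ∩ Y) ∩ h) ≤ 2·#(X ∩ Y ∩ h) + #(refl X ∩ transl t Y ∩ h)`.
PROOF: the demand vectors (rows of the certificate, restricted to the supply tokens inside `h`) are linearly independent in
`ℚ^{(W∩h) ⊕ (W∩h) ⊕ (E∩h)}` — a vanishing combination gives coefficient vectors `a, b, c` supported in `h` which satisfy the certificate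
equations at every `u ∈ h`, hence (the sums vanish at `u ∉ h` because `h` is an up-set) at every `u`, so `CertGenKernelAt` kills them —
and independent vectors are at most as many as the dimension. [this work] -/
theorem dipoleIneq_of_certGenKernel (hK : CertGenKernel) (X Y h : Finset (Finset α)) (t : Finset α)
    (hX : IsUpperSet (X : Set (Finset α))) (hY : IsUpperSet (Y : Set (Finset α))) (hh : IsUpperSet (h : Set (Finset α))) :
    (refl X ∩ Y ∩ h).card + (X ∩ refl Y ∩ h).card + (refl (X ∩ Y) ∩ h).card
      ≤ 2 * (X ∩ Y ∩ h).card + (refl X ∩ transl t Y ∩ h).card := by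
  obtain ⟨q, hq⟩ := hK α X Y t hX hY
  -- supply index type and the demand vectors
  set W := X ∩ Y ∩ h with hW
  set E := refl X ∩ transl t Y ∩ h with hE
  set D₁ := refl X ∩ Y ∩ h with hD₁
  set D₂ := X ∩ refl Y ∩ h with hD₂
  set D₃ := refl (X ∩ Y) ∩ h with hD₃
  let zeta : Finset α → Finset α → ℚ := fun d u => if d ⊆ u then 1 else 0
  let v₁ : ↥D₁ → (↥W ⊕ ↥W ⊕ ↥E → ℚ) := fun d =>
    Sum.elim (fun u => zeta (d : Finset α) (u : Finset α))
      (Sum.elim (fun u => qzeta q (d : Finset α) (u : Finset α)) (fun _ => 0))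
  let v₂ : ↥D₂ → (↥W ⊕ ↥W ⊕ ↥E → ℚ) := fun d =>
    Sum.elim (fun _ => 0) (Sum.elim (fun u => zeta (d : Finset α) (u : Finset α)) (fun _ => 0))
  let v₃ : ↥D₃ → (↥W ⊕ ↥W ⊕ ↥E → ℚ) := fun d =>
    Sum.elim (fun u => qzeta q (d : Finset α) (u : Finset α))
      (Sum.elim (fun _ => 0) (fun u => zeta (d : Finset α) (u : Finset α)))
  have hli : LinearIndependent ℚ (Sum.elim v₁ (Sum.elim v₂ v₃)) := by
    rw [Fintype.linearIndependent_iff]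
    intro g hg
    -- coefficient vectors on the cube
    obtain ⟨a, ha⟩ : ∃ f : Finset α → ℚ, ∀ d, f d = if hd : d ∈ D₁ then g (Sum.inl ⟨d, hd⟩) else 0 := ⟨_, fun _ => rfl⟩
    obtain ⟨b, hb⟩ : ∃ f : Finset α → ℚ, ∀ d, f d = if hd : d ∈ D₂ then g (Sum.inr (Sum.inl ⟨d, hd⟩)) else 0 := ⟨_, fun _ => rfl⟩
    obtain ⟨c, hc⟩ : ∃ f : Finset α → ℚ, ∀ d, f d = if hd : d ∈ D₃ then g (Sum.inr (Sum.inr ⟨d, hd⟩)) else 0 := ⟨_, fun _ => rfl⟩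
    have hasupp : ∀ d, a d ≠ 0 → d ∈ D₁ := by intro d hd; by_contra h'; rw [ha d, dif_neg h'] at hd; exact hd rfl
    have hbsupp : ∀ d, b d ≠ 0 → d ∈ D₂ := by intro d hd; by_contra h'; rw [hb d, dif_neg h'] at hd; exact hd rfl
    have hcsupp : ∀ d, c d ≠ 0 → d ∈ D₃ := by intro d hd; by_contra h'; rw [hc d, dif_neg h'] at hd; exact hd rfl
    -- sums over the index finsets are sums over the cube
    have sum1 : ∀ (φ : Finset α → ℚ), ∑ d : ↥D₁, g (Sum.inl d) * φ (d : Finset α) = ∑ d, a d * φ d := by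
      intro φ
      have h1 : ∑ d, a d * φ d = ∑ d ∈ D₁, a d * φ d := by
        refine (Finset.sum_subset (subset_univ _) ?_).symm
        intro d _ hd; rw [ha d, dif_neg hd, zero_mul]
      rw [h1]; conv_rhs => rw [← Finset.sum_coe_sort]
      refine Finset.sum_congr rfl fun d _ => ?_
      rw [ha d, dif_pos d.2]
    have sum2 : ∀ (φ : Finset α → ℚ), ∑ d : ↥D₂, g (Sum.inr (Sum.inl d)) * φ (d : Finset α) = ∑ d, b d * φ d := by
      intro φ
      have h1 : ∑ d, b d * φ d = ∑ d ∈ D₂, b d * φ d := by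
        refine (Finset.sum_subset (subset_univ _) ?_).symm
        intro d _ hd; rw [hb d, dif_neg hd, zero_mul]
      rw [h1]; conv_rhs => rw [← Finset.sum_coe_sort]
      refine Finset.sum_congr rfl fun d _ => ?_
      rw [hb d, dif_pos d.2]
    have sum3 : ∀ (φ : Finset α → ℚ), ∑ d : ↥D₃, g (Sum.inr (Sum.inr d)) * φ (d : Finset α) = ∑ d, c d * φ d := by
      intro φ
      have h1 : ∑ d, c d * φ d = ∑ d ∈ D₃, c d * φ d := by
        refine (Finset.sum_subset (subset_univ _) ?_).symm
        intro d _ hd; rw [hc d, dif_neg hd, zero_mul]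
      rw [h1]; conv_rhs => rw [← Finset.sum_coe_sort]
      refine Finset.sum_congr rfl fun d _ => ?_
      rw [hc d, dif_pos d.2]
    -- the three equations on `h`
    have EA : ∀ u, u ∈ W → ∑ d, a d * zeta d u + ∑ d, c d * qzeta q d u = 0 := by
      intro u hu
      have h0 := congrFun hg (Sum.inl ⟨u, hu⟩)
      rw [Finset.sum_apply, Fintype.sum_sum_type, Fintype.sum_sum_type] at h0
      simp only [Pi.smul_apply, smul_eq_mul, Pi.zero_apply, Sum.elim_inl, Sum.elim_inr, v₁, v₂, v₃, mul_zero,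
        Finset.sum_const_zero, zero_add] at h0
      rw [sum1 (fun d => zeta d u), sum3 (fun d => qzeta q d u)] at h0
      exact h0
    have EB : ∀ u, u ∈ W → ∑ d, a d * qzeta q d u + ∑ d, b d * zeta d u = 0 := by
      intro u hu
      have h0 := congrFun hg (Sum.inr (Sum.inl ⟨u, hu⟩))
      rw [Finset.sum_apply, Fintype.sum_sum_type, Fintype.sum_sum_type] at h0
      simp only [Pi.smul_apply, smul_eq_mul, Pi.zero_apply, Sum.elim_inl, Sum.elim_inr, v₁, v₂, v₃, mul_zero,
        Finset.sum_const_zero, add_zero] at h0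
      rw [sum1 (fun d => qzeta q d u), sum2 (fun d => zeta d u)] at h0
      exact h0
    have EE : ∀ u, u ∈ E → ∑ d, c d * zeta d u = 0 := by
      intro u hu
      have h0 := congrFun hg (Sum.inr (Sum.inr ⟨u, hu⟩))
      rw [Finset.sum_apply, Fintype.sum_sum_type, Fintype.sum_sum_type] at h0
      simp only [Pi.smul_apply, smul_eq_mul, Pi.zero_apply, Sum.elim_inl, Sum.elim_inr, v₁, v₂, v₃, mul_zero,
        Finset.sum_const_zero, zero_add] at h0
      rw [sum3 (fun d => zeta d u)] at h0
      exact h0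
    -- extend the equations from `h` to the whole cube (supports lie in `h`, `h` is an up-set)
    have hzeta : ∀ d u : Finset α, ¬ d ⊆ u → zeta d u = 0 := by intro d u hdu; simp only [zeta, if_neg hdu]
    have hqz : ∀ d u : Finset α, ¬ d ⊆ u → qzeta q d u = 0 := fun d u hdu => qzeta_eq_zero_of_not_subset hdu
    have ha_h : ∀ d, a d ≠ 0 → d ∈ h := fun d hd => (mem_inter.1 (hasupp d hd)).2
    have hb_h : ∀ d, b d ≠ 0 → d ∈ h := fun d hd => (mem_inter.1 (hbsupp d hd)).2
    have hc_h : ∀ d, c d ≠ 0 → d ∈ h := fun d hd => (mem_inter.1 (hcsupp d hd)).2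
    have res := hq a b c
      (fun d hd => (mem_inter.1 (hasupp d hd)).1) (fun d hd => (mem_inter.1 (hbsupp d hd)).1)
      (fun d hd => (mem_inter.1 (hcsupp d hd)).1)
      (by
        intro u hu
        by_cases huh : u ∈ h
        · exact EA u (mem_inter.2 ⟨hu, huh⟩)
        · rw [sum_supported_eq_zero_of_not_mem hh a zeta hzeta ha_h u huh,
            sum_supported_eq_zero_of_not_mem hh c (qzeta q) hqz hc_h u huh, add_zero])
      (by
        intro u hu
        by_cases huh : u ∈ h
        · exact EB u (mem_inter.2 ⟨hu, huh⟩)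
        · rw [sum_supported_eq_zero_of_not_mem hh a (qzeta q) hqz ha_h u huh,
            sum_supported_eq_zero_of_not_mem hh b zeta hzeta hb_h u huh, add_zero])
      (by
        intro u hu
        by_cases huh : u ∈ h
        · exact EE u (mem_inter.2 ⟨hu, huh⟩)
        · exact sum_supported_eq_zero_of_not_mem hh c zeta hzeta hc_h u huh)
    obtain ⟨haz, hbz, hcz⟩ := res
    intro i
    rcases i with d | d | d
    · have := ha d; rw [dif_pos d.2] at this; rw [← this]; exact haz d
    · have := hb d; rw [dif_pos d.2] at this; rw [← this]; exact hbz d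
    · have := hc d; rw [dif_pos d.2] at this; rw [← this]; exact hcz d
  -- counting: number of independent vectors ≤ dimension
  have hcard := hli.fintype_card_le_finrank
  rw [Module.finrank_fintype_fun_eq_card, Fintype.card_sum, Fintype.card_sum, Fintype.card_sum, Fintype.card_sum,
    Fintype.card_coe, Fintype.card_coe, Fintype.card_coe, Fintype.card_coe, Fintype.card_coe] at hcard
  omega

end FiveUpSet

end Summit.CriticalPhenomena.PercolationContinuityZ3.Theorems
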